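import Mathlib
import HarnessLib
import Summits.KontsevichZagierPeriods.KontsevichZagierPeriods.Theorems.SoloInformedLogRoomCore
import Summits.KontsevichZagierPeriods.KontsevichZagierPeriods.Theorems.SoloInformedLogRoomEndpoint
import Summits.KontsevichZagierPeriods.KontsevichZagierPeriods.Theorems.SoloInformedLogRoomLeftRight
import Summits.KontsevichZagierPeriods.KontsevichZagierPeriods.Theorems.SoloInformedLogRoomBounded

/-!
# SoloInformed — log-room estimates V: the one-variable log-room lemma, unbounded fibre (LEMMA I programme, file F1e)

Solo programme `solo-KontsevichZagierPeriods-informed`, session s140; the ONE-VARIABLE LOG-ROOM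
LEMMA on an unbounded fibre: `soloInformed_logRoom_Ioi` — for `0 ≤ α₀`, `d ≤ α₀`, `K ≥ 0`,
`∫⁻_{(α₀,∞)} u^r (K + |log |u-d||)^p ≤ C(r,p) Λ^p ∫⁻_{(α₀,∞)} u^r` with
`Λ = 1 + K + log⁺|d| + log⁺ α₀ + log⁺ α₀⁻¹`.  The growth of `log u` at infinity is absorbed into
the power weight (`log (u/α₀) ≤ (u/α₀)^ε/ε` with `εp = (-1-r)/2`, possible since a finite mass on
`(α₀, ∞)` forces `r < -1`), the singularity at `α₀` is file F1c.  References: J.-M. Lion,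
J.-P. Rolin, Ann. Inst. Fourier 48 (1998) 755–767, §1; G. Comte, J.-M. Lion, J.-P. Rolin,
Illinois J. Math. 44 (2000) 884–888, Thm. 3.
-/

noncomputable section

open scoped ENNReal
open MeasureTheory Set Real

namespace Summit.KontsevichZagierPeriods.KontsevichZagierPeriods.Theorems

/-! ### Pointwise reductions and the growth term -/

/-- Pointwise reduction on an unbounded fibre: for `0 < α₀ < u`, `d ≤ α₀`,
`|log |u-d|| ≤ (1 + log⁺ α₀ + log⁺ |d|) + log⁺ (u-α₀)⁻¹ + log (u/α₀)`. [cite: LionRolin1998, §1] -/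
theorem soloInformed_abs_log_abs_sub_le_Ioi {α₀ d u : ℝ} (hα : 0 < α₀) (hu : α₀ < u) (hd : d ≤ α₀) :
    |Real.log (|u - d|)| ≤ (1 + log⁺ α₀ + log⁺ |d|) + log⁺ (u - α₀)⁻¹ + Real.log (u / α₀) := by
  have hu0 : 0 < u := hα.trans hu
  have h1 := soloInformed_abs_log_le_posLog |u - d|
  have hG : log⁺ u ≤ log⁺ α₀ + Real.log (u / α₀) := by
    have h1u : 1 ≤ u / α₀ := (one_le_div hα).2 hu.le
    calc log⁺ u = log⁺ (α₀ * (u / α₀)) := by rw [mul_div_cancel₀ u hα.ne']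
      _ ≤ log⁺ α₀ + log⁺ (u / α₀) := Real.posLog_mul
      _ = log⁺ α₀ + Real.log (u / α₀) := by rw [soloInformed_posLog_eq_log_of_one_le h1u]
  have h2 : log⁺ |u - d| ≤ 1 + log⁺ u + log⁺ |d| := soloInformed_posLog_abs_sub_le hu0.le
  have h3 : log⁺ |u - d|⁻¹ ≤ log⁺ (u - α₀)⁻¹ :=
    soloInformed_posLog_inv_antitone (by linarith) (by
      rw [abs_of_nonneg (by linarith)]; linarith)
  linarith

/-- Growth at infinity absorbed into the power weight: for `r < -1`, `0 < p`, `ε p = (-1-r)/2`,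
`0 < α₀ < u`: `u^r (log (u/α₀))^p ≤ ε⁻¹^p α₀^{-εp} u^{r+εp}`. [cite: LionRolin1998, §1] -/
theorem soloInformed_rpow_mul_log_pow_le {r ε α₀ u : ℝ} (p : ℕ) (hε : 0 < ε) (hα : 0 < α₀) (hu : α₀ < u) :
    u ^ r * (Real.log (u / α₀)) ^ p ≤ ε⁻¹ ^ p * α₀ ^ (-(ε * p)) * u ^ (r + ε * p) := by
  have hu0 : 0 < u := hα.trans hu
  have h1u : 1 ≤ u / α₀ := (one_le_div hα).2 hu.le
  have hlog0 : 0 ≤ Real.log (u / α₀) := Real.log_nonneg h1u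
  have hlog : Real.log (u / α₀) ≤ (u / α₀) ^ ε / ε := Real.log_le_rpow_div (by positivity) hε
  have h2 : (Real.log (u / α₀)) ^ p ≤ ((u / α₀) ^ ε / ε) ^ p := pow_le_pow_left₀ hlog0 hlog p
  have h3 : ((u / α₀) ^ ε / ε) ^ p = ε⁻¹ ^ p * α₀ ^ (-(ε * p)) * u ^ (ε * p) := by
    rw [div_pow, ← Real.rpow_natCast ((u / α₀) ^ ε) p, ← Real.rpow_mul (by positivity),
      Real.div_rpow hu0.le hα.le, Real.rpow_neg hα.le, inv_pow]
    field_simp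
  calc u ^ r * (Real.log (u / α₀)) ^ p ≤ u ^ r * ((u / α₀) ^ ε / ε) ^ p :=
        mul_le_mul_of_nonneg_left h2 (Real.rpow_nonneg hu0.le r)
    _ = ε⁻¹ ^ p * α₀ ^ (-(ε * p)) * (u ^ r * u ^ (ε * p)) := by rw [h3]; ring
    _ = ε⁻¹ ^ p * α₀ ^ (-(ε * p)) * u ^ (r + ε * p) := by rw [← Real.rpow_add hu0]

/-- The growth term integrates to twice the mass: for `r < -1`, `0 < p`, `0 < α₀`, with
`ε = (-1-r)/(2p)`: `∫⁻_{(α₀,∞)} u^r (log (u/α₀))^p ≤ 2 ε⁻¹^p ∫⁻_{(α₀,∞)} u^r`.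
[cite: LionRolin1998, §1] -/
theorem soloInformed_lintegral_growth_Ioi {r : ℝ} (hr : r < -1) {p : ℕ} (hp : 0 < p) {α₀ : ℝ}
    (hα : 0 < α₀) :
    ∫⁻ u in Ioi α₀, ENNReal.ofReal (u ^ r * (Real.log (u / α₀)) ^ p) ≤
      ENNReal.ofReal (2 * ((-1 - r) / (2 * p))⁻¹ ^ p) * ∫⁻ u in Ioi α₀, ENNReal.ofReal (u ^ r) := by
  have hp' : (0 : ℝ) < p := by exact_mod_cast hp
  set ε : ℝ := (-1 - r) / (2 * p) with hε_def
  have hε : 0 < ε := div_pos (by linarith) (by positivity)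
  have hεp : ε * p = (-1 - r) / 2 := by rw [hε_def]; field_simp
  have hγ : r + ε * p < -1 := by rw [hεp]; linarith
  set B : ℝ := ε⁻¹ ^ p * α₀ ^ (-(ε * p)) with hB_def
  have hB : 0 ≤ B := by positivity
  have hIr : ∫⁻ u in Ioi α₀, ENNReal.ofReal (u ^ r) = ENNReal.ofReal (α₀ ^ (r + 1) / (-(r + 1))) :=
    soloInformed_lintegral_rpow_Ioi hr hα
  have hkey : B * (α₀ ^ (r + ε * p + 1) / (-(r + ε * p + 1))) = 2 * ε⁻¹ ^ p * (α₀ ^ (r + 1) / (-(r + 1))) := by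
    rw [hB_def]
    have h1 : α₀ ^ (-(ε * p)) * α₀ ^ (r + ε * p + 1) = α₀ ^ (r + 1) := by
      rw [← Real.rpow_add hα]; ring_nf
    have h2 : -(r + ε * p + 1) = -(r + 1) / 2 := by rw [hεp]; ring
    have h3 : -(r + 1) ≠ 0 := by intro h; linarith
    rw [h2]
    calc ε⁻¹ ^ p * α₀ ^ (-(ε * p)) * (α₀ ^ (r + ε * p + 1) / (-(r + 1) / 2))
        = 2 * ε⁻¹ ^ p * ((α₀ ^ (-(ε * p)) * α₀ ^ (r + ε * p + 1)) / (-(r + 1))) := by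
          field_simp
      _ = 2 * ε⁻¹ ^ p * (α₀ ^ (r + 1) / (-(r + 1))) := by rw [h1]
  calc ∫⁻ u in Ioi α₀, ENNReal.ofReal (u ^ r * (Real.log (u / α₀)) ^ p)
      ≤ ∫⁻ u in Ioi α₀, ENNReal.ofReal (B * u ^ (r + ε * p)) :=
        setLIntegral_mono' measurableSet_Ioi fun u hu =>
          ENNReal.ofReal_le_ofReal (soloInformed_rpow_mul_log_pow_le p hε hα hu)
    _ = ENNReal.ofReal B * ENNReal.ofReal (α₀ ^ (r + ε * p + 1) / (-(r + ε * p + 1))) := by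
        rw [soloInformed_setLIntegral_ofReal_const_mul hB, soloInformed_lintegral_rpow_Ioi hγ hα]
    _ = ENNReal.ofReal (2 * ε⁻¹ ^ p) * ∫⁻ u in Ioi α₀, ENNReal.ofReal (u ^ r) := by
        rw [← ENNReal.ofReal_mul hB, hkey, ENNReal.ofReal_mul (p := 2 * ε⁻¹ ^ p) (by positivity), hIr]

/-! ### The one-variable log-room lemma, unbounded fibre -/

/-- `∫⁻_{(0,∞)} u^r = ∞` for every real `r`. [cite: LionRolin1998, §1] -/
theorem soloInformed_lintegral_rpow_Ioi_zero_eq_top (r : ℝ) :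
    ∫⁻ u in Ioi (0 : ℝ), ENNReal.ofReal (u ^ r) = ⊤ := by
  rcases le_or_gt r (-1) with hr | hr
  · apply top_le_iff.1
    rw [← soloInformed_lintegral_rpow_Ioo_eq_top hr one_pos]
    exact lintegral_mono_set Ioo_subset_Ioi_self
  · exact soloInformed_lintegral_rpow_Ioi_eq_top hr.le le_rfl

/-- ONE-VARIABLE LOG-ROOM LEMMA (unbounded fibre). For every `r` and `p` there is `C ≥ 1` such that
for all `0 ≤ α₀`, `d ≤ α₀` and `K ≥ 0`:
`∫⁻_{(α₀,∞)} u^r (K + |log |u-d||)^p ≤ C Λ^p ∫⁻_{(α₀,∞)} u^r`,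
`Λ = 1 + K + log⁺|d| + log⁺ α₀ + log⁺ α₀⁻¹`. [cite: LionRolin1998, §1] -/
theorem soloInformed_logRoom_Ioi (r : ℝ) (p : ℕ) :
    ∃ C : ℝ, 1 ≤ C ∧ ∀ (α₀ d K : ℝ), 0 ≤ α₀ → d ≤ α₀ → 0 ≤ K →
      ∫⁻ u in Ioi α₀, ENNReal.ofReal (u ^ r * (K + |Real.log (|u - d|)|) ^ p) ≤
        ENNReal.ofReal (C * (1 + K + log⁺ |d| + log⁺ α₀ + log⁺ α₀⁻¹) ^ p) *
          ∫⁻ u in Ioi α₀, ENNReal.ofReal (u ^ r) := by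
  rcases Nat.eq_zero_or_pos p with hp | hp
  · subst hp
    refine ⟨1, le_rfl, fun α₀ d K _ _ _ => ?_⟩
    simp only [pow_zero, mul_one, ENNReal.ofReal_one, one_mul, le_refl]
  have hp' : (0 : ℝ) < p := by exact_mod_cast hp
  obtain ⟨C₁, hC₁, h₁⟩ := soloInformed_logRoom_leftEndpoint_gen r hp
  -- growth constant (only used when `r < -1`)
  set E : ℝ := max 1 (2 * ((-1 - r) / (2 * p))⁻¹ ^ p) with hE_def
  have hE1 : 1 ≤ E := le_max_left _ _
  refine ⟨4 ^ p * (1 + C₁ + E), ?_, ?_⟩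
  · have h4 : (1 : ℝ) ≤ 4 ^ p := one_le_pow₀ (by norm_num)
    exact one_le_mul_of_one_le_of_one_le h4 (by linarith)
  intro α₀ d K hα hd hK
  set J := Ioi α₀ with hJ_def
  set I := ∫⁻ u in J, ENNReal.ofReal (u ^ r) with hI_def
  set Λ : ℝ := 1 + K + log⁺ |d| + log⁺ α₀ + log⁺ α₀⁻¹ with hΛ_def
  have hl1 : 0 ≤ log⁺ |d| := Real.posLog_nonneg
  have hl2 : 0 ≤ log⁺ α₀ := Real.posLog_nonneg
  have hl4 : 0 ≤ log⁺ α₀⁻¹ := Real.posLog_nonneg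
  have hΛ1 : 1 ≤ Λ := by rw [hΛ_def]; linarith
  have hΛ0 : 0 ≤ Λ := zero_le_one.trans hΛ1
  have hC₁0 : 0 ≤ C₁ := zero_le_one.trans hC₁
  have hE0 : 0 ≤ E := zero_le_one.trans hE1
  have hCpos : 0 < 4 ^ p * (1 + C₁ + E) * Λ ^ p := by positivity
  -- trivial when the mass is infinite
  by_cases hI : I = ⊤
  · rw [hI]; exact soloInformed_le_ofReal_mul_top hCpos _
  -- hence `0 < α₀` and `r < -1`
  have hα0 : 0 < α₀ := by
    rcases hα.eq_or_lt with h | h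
    · exact absurd (by rw [hI_def, hJ_def, ← h]; exact soloInformed_lintegral_rpow_Ioi_zero_eq_top r) hI
    · exact h
  have hr : r < -1 := by
    by_contra h
    exact hI (soloInformed_lintegral_rpow_Ioi_eq_top (not_lt.1 h) hα)
  set K₂ : ℝ := 1 + log⁺ α₀ + log⁺ |d| + K with hK₂_def
  have hK₂ : 0 ≤ K₂ := by rw [hK₂_def]; linarith
  have hK₂Λ : K₂ ≤ Λ := by rw [hK₂_def, hΛ_def]; linarith
  have hpt : ∀ u ∈ J, ENNReal.ofReal (u ^ r * (K + |Real.log (|u - d|)|) ^ p) ≤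
      ENNReal.ofReal (4 ^ p * K₂ ^ p * u ^ r) +
        ENNReal.ofReal (4 ^ p * u ^ r * (log⁺ (u - α₀)⁻¹) ^ p) +
        ENNReal.ofReal (4 ^ p * (u ^ r * (Real.log (u / α₀)) ^ p)) := by
    intro u hu
    have hu' : α₀ < u := hu
    have hu0 : 0 < u := hα0.trans hu'
    have hur : 0 ≤ u ^ r := Real.rpow_nonneg hu0.le r
    have hA : 0 ≤ log⁺ (u - α₀)⁻¹ := Real.posLog_nonneg
    have hG : 0 ≤ Real.log (u / α₀) := Real.log_nonneg ((one_le_div hα0).2 hu'.le)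
    have hred := soloInformed_abs_log_abs_sub_le_Ioi hα0 hu' hd
    have hsum : K + |Real.log (|u - d|)| ≤ K₂ + log⁺ (u - α₀)⁻¹ + Real.log (u / α₀) := by
      rw [hK₂_def]; linarith
    have h0 : 0 ≤ K + |Real.log (|u - d|)| := add_nonneg hK (abs_nonneg _)
    have h3 := (pow_le_pow_left₀ h0 hsum p).trans (soloInformed_add_add_pow_le p hK₂ hA hG)
    rw [← ENNReal.ofReal_add (by positivity) (by positivity),
      ← ENNReal.ofReal_add (by positivity) (by positivity)]
    apply ENNReal.ofReal_le_ofReal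
    calc u ^ r * (K + |Real.log (|u - d|)|) ^ p
        ≤ u ^ r * (4 ^ p * (K₂ ^ p + (log⁺ (u - α₀)⁻¹) ^ p + (Real.log (u / α₀)) ^ p)) :=
          mul_le_mul_of_nonneg_left h3 hur
      _ = _ := by ring
  have hIK : ∫⁻ u in J, ENNReal.ofReal (4 ^ p * K₂ ^ p * u ^ r) ≤ ENNReal.ofReal (4 ^ p * 1 * Λ ^ p) * I := by
    rw [soloInformed_setLIntegral_ofReal_const_mul (by positivity)]
    refine mul_le_mul_of_nonneg_right (ENNReal.ofReal_le_ofReal ?_) zero_le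
    rw [mul_one]
    exact mul_le_mul_of_nonneg_left (pow_le_pow_left₀ hK₂ hK₂Λ p) (by positivity)
  have hIA : ∫⁻ u in J, ENNReal.ofReal (4 ^ p * u ^ r * (log⁺ (u - α₀)⁻¹) ^ p) ≤
      ENNReal.ofReal (4 ^ p * C₁ * Λ ^ p) * I := by
    have hrw : ∫⁻ u in J, ENNReal.ofReal (4 ^ p * u ^ r * (log⁺ (u - α₀)⁻¹) ^ p) =
        ENNReal.ofReal (4 ^ p) * ∫⁻ u in J, ENNReal.ofReal (u ^ r * (log⁺ (u - α₀)⁻¹) ^ p) := by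
      rw [← soloInformed_setLIntegral_ofReal_const_mul (by positivity)]
      congr 1 with u; congr 1; ring
    rw [hrw]
    set L : ℝ := min α₀ 1 with hL_def
    have hL : 0 < L := lt_min hα0 one_pos
    have hLα : L ≤ α₀ := min_le_left _ _
    have hL1 : L ≤ 1 := min_le_right _ _
    have hTJ : Ioo α₀ (α₀ + L) ⊆ J := fun u hu => hu.1
    have := h₁ α₀ L J hα0 hL hLα hL1 measurableSet_Ioi hTJ subset_rfl
    have hΛ' : 1 + log⁺ L⁻¹ ≤ Λ := by
      have h2 : log⁺ L⁻¹ ≤ log⁺ α₀⁻¹ + log⁺ (1 : ℝ)⁻¹ := soloInformed_posLog_inv_min_le _ _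
      have h3 : log⁺ (1 : ℝ)⁻¹ = 0 := by
        rw [inv_one]; exact soloInformed_posLog_eq_zero_of_le_one zero_le_one le_rfl
      rw [hΛ_def]; linarith
    have hL0 : 0 ≤ 1 + log⁺ L⁻¹ := add_nonneg zero_le_one Real.posLog_nonneg
    calc ENNReal.ofReal (4 ^ p) * ∫⁻ u in J, ENNReal.ofReal (u ^ r * (log⁺ (u - α₀)⁻¹) ^ p)
        ≤ ENNReal.ofReal (4 ^ p) * (ENNReal.ofReal (C₁ * (1 + log⁺ L⁻¹) ^ p) * I) := by gcongr
      _ = ENNReal.ofReal (4 ^ p * (C₁ * (1 + log⁺ L⁻¹) ^ p)) * I := by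
          rw [ENNReal.ofReal_mul (p := 4 ^ p) (by positivity), mul_assoc]
      _ ≤ ENNReal.ofReal (4 ^ p * C₁ * Λ ^ p) * I := by
          refine mul_le_mul_of_nonneg_right (ENNReal.ofReal_le_ofReal ?_) zero_le
          calc 4 ^ p * (C₁ * (1 + log⁺ L⁻¹) ^ p) ≤ 4 ^ p * (C₁ * Λ ^ p) := by gcongr
            _ = 4 ^ p * C₁ * Λ ^ p := by ring
  have hIG : ∫⁻ u in J, ENNReal.ofReal (4 ^ p * (u ^ r * (Real.log (u / α₀)) ^ p)) ≤
      ENNReal.ofReal (4 ^ p * E * Λ ^ p) * I := by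
    rw [soloInformed_setLIntegral_ofReal_const_mul (by positivity)]
    have := soloInformed_lintegral_growth_Ioi hr hp hα0
    have hgE : 2 * ((-1 - r) / (2 * p))⁻¹ ^ p ≤ E := le_max_right _ _
    calc ENNReal.ofReal (4 ^ p) * ∫⁻ u in J, ENNReal.ofReal (u ^ r * (Real.log (u / α₀)) ^ p)
        ≤ ENNReal.ofReal (4 ^ p) * (ENNReal.ofReal (2 * ((-1 - r) / (2 * p))⁻¹ ^ p) * I) := by gcongr
      _ = ENNReal.ofReal (4 ^ p * (2 * ((-1 - r) / (2 * p))⁻¹ ^ p)) * I := by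
          rw [ENNReal.ofReal_mul (p := 4 ^ p) (by positivity), mul_assoc]
      _ ≤ ENNReal.ofReal (4 ^ p * E * Λ ^ p) * I := by
          refine mul_le_mul_of_nonneg_right (ENNReal.ofReal_le_ofReal ?_) zero_le
          calc 4 ^ p * (2 * ((-1 - r) / (2 * ↑p))⁻¹ ^ p) ≤ 4 ^ p * E := by gcongr
            _ = 4 ^ p * E * 1 := (mul_one _).symm
            _ ≤ 4 ^ p * E * Λ ^ p := by gcongr; exact one_le_pow₀ hΛ1
  have hmeas1 : Measurable fun u : ℝ => ENNReal.ofReal (4 ^ p * K₂ ^ p * u ^ r) :=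
    soloInformed_measurable_ofReal_const_mul_rpow _ r
  have hmeas2 : Measurable fun u : ℝ => ENNReal.ofReal (4 ^ p * u ^ r * (log⁺ (u - α₀)⁻¹) ^ p) :=
    soloInformed_measurable_weight_posLog (measurable_id.sub_const α₀) _ r p
  have hmeas12 : Measurable fun u : ℝ => ENNReal.ofReal (4 ^ p * K₂ ^ p * u ^ r) +
      ENNReal.ofReal (4 ^ p * u ^ r * (log⁺ (u - α₀)⁻¹) ^ p) := hmeas1.add hmeas2
  calc ∫⁻ u in J, ENNReal.ofReal (u ^ r * (K + |Real.log (|u - d|)|) ^ p)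
      ≤ ∫⁻ u in J, (ENNReal.ofReal (4 ^ p * K₂ ^ p * u ^ r) +
          ENNReal.ofReal (4 ^ p * u ^ r * (log⁺ (u - α₀)⁻¹) ^ p) +
          ENNReal.ofReal (4 ^ p * (u ^ r * (Real.log (u / α₀)) ^ p))) := setLIntegral_mono' measurableSet_Ioi hpt
    _ = (∫⁻ u in J, ENNReal.ofReal (4 ^ p * K₂ ^ p * u ^ r)) +
          (∫⁻ u in J, ENNReal.ofReal (4 ^ p * u ^ r * (log⁺ (u - α₀)⁻¹) ^ p)) +
          ∫⁻ u in J, ENNReal.ofReal (4 ^ p * (u ^ r * (Real.log (u / α₀)) ^ p)) := by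
        rw [lintegral_add_left hmeas12, lintegral_add_left hmeas1]
    _ ≤ ENNReal.ofReal (4 ^ p * 1 * Λ ^ p) * I + ENNReal.ofReal (4 ^ p * C₁ * Λ ^ p) * I +
          ENNReal.ofReal (4 ^ p * E * Λ ^ p) * I := by
        gcongr
    _ = ENNReal.ofReal (4 ^ p * (1 + C₁ + E) * Λ ^ p) * I := by
        rw [← add_mul, ← add_mul, ← ENNReal.ofReal_add (by positivity) (by positivity),
          ← ENNReal.ofReal_add (by positivity) (by positivity)]
        congr 2; ring

end Summit.KontsevichZagierPeriods.KontsevichZagierPeriods.Theorems
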